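import Summits.Parity.BatemanHorn.Theorems.SystemZeroRepulsion.Negative.StubSmoothPeriodicFactorisationLoadBearing

/-!
# Stub S5 `stub_roughEquidistribution` of line `smooth-rough-lattice-acquisition` — `leadingCoeff_pos` and `hasNoFixedPrimeDivisor` are NOT load-bearing

Small-model facts (refuter, drefute gen 3, 2026-08-16) for stub S5 of the line
`Cruxes/SystemZeroRepulsion/Lines/smooth-rough-lattice-acquisition.lean` (sha 5e06eb842271) of the crux
`Summit.Parity.BatemanHorn.Theses.AlmostPrimeZeros.SystemZeroRepulsion` (stmt-Parity-11291):

  S5  `∀ (k,f) BH, ∀ m₀, ∃ δ > 0, ∃ C x₀, ∀ x ≥ x₀, ∀ z (‖z−1‖ ≤ 3 log log x), ∀ d a, 0 < d → d ∣ Q(x) →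
       ‖ClassSum_x(m₀; d, a; z) − R_x(m₀; z)/d‖ ≤ (x/d)·U^{k(Re z−1)}·exp(C‖z−1‖ log(‖z−1‖+2))·(log x)^{−δ}`,
  `Q(x) = ∏_{p ≤ log log x} p²`, `U = log x / log log log x`, rough statistic `s♯_x` (primes `> log log x`).

The CONCLUSION of S5 holds for the two junk models through which `leadingCoeff_pos` resp. `hasNoFixedPrimeDivisor`
could bite — `![-X]` (`Int.toNat` kills the statistic) and the constant prime `![C 3]` (once `log log x ≥ 3` the prime
`3` is smooth) — with `δ = 1`, `C = 0`: the rough statistic vanishes identically, both sums COUNT integers, the left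
side is `|#{m₀ ≤ n ≤ x : n ≡ a (d)} − (x+1−m₀)/d| ≤ 1` (`abs_card_filter_modEq_sub_le`), while the right side is
`≥ (x/d)·U^{−3 log log x}·(log x)^{−1} ≥ x·(log x)^{−3 log log x − 4} ≥ 1` for large `x` (`d ≤ Q ≤ (log x)³`,
`1 ≤ U ≤ log x`, `Re z − 1 ≥ −3 log log x`).  Together with the gen-2 briefing (irreducible / pairwise_not_associated
ARE load-bearing for S5, at `z = 2`, `d = 4`, by the size coupling `x U²/L₃ ≫ x U (log x)^{−δ}` — asymptotic, not
formalised) this fixes the hypothesis profile of S5: a proof of S5 can consume only `irreducible` + `pairwise_not_associated`.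
-/

noncomputable section

open Filter Polynomial Finset
open scoped Topology

namespace Summit.Parity.BatemanHorn.Theorems.SystemZeroRepulsion.Negative

open Literature.NumberTheory.Sieve
open Summit.Parity.BatemanHorn.Theorems.SystemLSDRealSegment.Negative

/-! ## Left side: with a vanishing statistic both sums count integers -/

/-- If the exponent vanishes identically, `‖ClassSum − R/d‖ = |N(d,a) − (x+1−m₀)/d| ≤ 1`. [folklore] -/
theorem norm_classSum_sub_le_one_of_stat_zero {e : ℕ → ℕ} (he : ∀ n, e n = 0) (m₀ x a : ℕ) {d : ℕ}
    (hd : 0 < d) (z : ℂ) :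
    ‖(∑ n ∈ (Finset.Ico m₀ (x + 1)).filter (fun n : ℕ => n ≡ a [MOD d]), z ^ (e n)) -
        (∑ n ∈ Finset.Ico m₀ (x + 1), z ^ (e n)) / (d : ℂ)‖ ≤ 1 := by
  have h1 : (∑ n ∈ (Finset.Ico m₀ (x + 1)).filter (fun n : ℕ => n ≡ a [MOD d]), z ^ (e n)) =
      (((((Finset.Ico m₀ (x + 1)).filter (fun n : ℕ => n ≡ a [MOD d])).card : ℕ) : ℝ) : ℂ) := by
    simp [he]
  have h2 : (∑ n ∈ Finset.Ico m₀ (x + 1), z ^ (e n)) = ((((x + 1 - m₀ : ℕ)) : ℝ) : ℂ) := by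
    simp [he]
  rw [h1, h2, show ((((x + 1 - m₀ : ℕ)) : ℝ) : ℂ) / (d : ℂ) = ((((x + 1 - m₀ : ℕ) : ℝ) / (d : ℝ) : ℝ) : ℂ) by
    push_cast; rfl, ← Complex.ofReal_sub, Complex.norm_real, Real.norm_eq_abs]
  exact abs_card_filter_modEq_sub_le m₀ x a hd

/-! ## Right side: the S5 budget with `C = 0`, `δ = 1`, `k = 1` is eventually `≥ 1` uniformly on the disc -/

/-- `(3 log u + 4) log u ≤ u` for large `u`. [folklore] -/
theorem eventually_loglog_budget : ∀ᶠ u : ℝ in atTop, (3 * Real.log u + 4) * Real.log u ≤ u := by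
  have h := Real.tendsto_pow_log_div_mul_add_atTop 1 0 2 one_ne_zero
  have h8 : (0 : ℝ) < 1 / 8 := by norm_num
  filter_upwards [h.eventually (gt_mem_nhds h8), eventually_ge_atTop (Real.exp 1)] with u hu hue
  have hu0 : 0 < u := (Real.exp_pos 1).trans_le hue
  have hlog1 : 1 ≤ Real.log u := by
    rw [← Real.log_exp 1]; exact Real.log_le_log (Real.exp_pos 1) hue
  have hsq : Real.log u ^ 2 < 1 / 8 * u := by
    have : Real.log u ^ 2 / (1 * u + 0) < 1 / 8 := hu
    rw [one_mul, add_zero, div_lt_iff₀ hu0] at this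
    linarith
  nlinarith [hsq, hlog1]

/-- Along the naturals: eventually `1 ≤ log log log x`, `3 ≤ log log x` and `(log x)^{3 log log x + 4} ≤ x`. [folklore] -/
theorem eventually_junk_scales : ∀ᶠ x : ℕ in atTop, 3 ≤ Real.log (Real.log (x : ℝ)) ∧
    1 ≤ Real.log (Real.log (Real.log (x : ℝ))) ∧ 1 < Real.log (x : ℝ) ∧
    Real.log (x : ℝ) ^ (3 * Real.log (Real.log (x : ℝ)) + 4) ≤ (x : ℝ) := by
  have hlog : Tendsto (fun x : ℕ => Real.log (x : ℝ)) atTop atTop :=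
    Real.tendsto_log_atTop.comp tendsto_natCast_atTop_atTop
  filter_upwards [tendsto_loglog_atTop.eventually_ge_atTop 3, tendsto_logloglog_atTop.eventually_ge_atTop 1,
    hlog.eventually eventually_loglog_budget, hlog.eventually_gt_atTop 1, eventually_ge_atTop 3]
    with x h3 h1 hb hl1 hx3
  refine ⟨h3, h1, hl1, ?_⟩
  have hx0 : (0 : ℝ) < x := by exact_mod_cast (show 0 < x by omega)
  have hlx : 0 < Real.log (x : ℝ) := Real.log_pos (by exact_mod_cast (show 1 < x by omega))
  -- `(log x)^{3L+4} = exp((3L+4)·L) ≤ exp(log x) = x`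
  rw [Real.rpow_def_of_pos hlx, ← Real.exp_log hx0]
  refine Real.exp_le_exp.2 ?_
  rw [Real.exp_log hx0]
  have : (3 * Real.log (Real.log (x : ℝ)) + 4) * Real.log (Real.log (x : ℝ)) ≤ Real.log (x : ℝ) := hb
  linarith [this]

/-- The S5 budget at `k = 1`, `C = 0`, `δ = 1` dominates `1`, for all `z` in the disc and all `0 < d ∣ Q(x)`, once the
scales of `eventually_junk_scales` hold. [folklore] -/
theorem one_le_junk_budget {x : ℕ} (h3 : 3 ≤ Real.log (Real.log (x : ℝ)))
    (h1 : 1 ≤ Real.log (Real.log (Real.log (x : ℝ)))) (hlx1 : 1 < Real.log (x : ℝ))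
    (hb : Real.log (x : ℝ) ^ (3 * Real.log (Real.log (x : ℝ)) + 4) ≤ (x : ℝ))
    {z : ℂ} (hz : ‖z - 1‖ ≤ 3 * Real.log (Real.log (x : ℝ))) {d : ℕ} (hd : 0 < d)
    (hdQ : d ∣ (∏ p ∈ Nat.primesLE ⌊Real.log (Real.log (x : ℝ))⌋₊, p ^ 2)) :
    1 ≤ (x : ℝ) / (d : ℝ) * (Real.log (x : ℝ) / Real.log (Real.log (Real.log (x : ℝ)))) ^ (((1 : ℕ) : ℝ) * (z.re - 1)) *
      Real.exp (0 * ‖(z : ℂ) - 1‖ * Real.log (‖(z : ℂ) - 1‖ + 2)) * (Real.log (x : ℝ)) ^ (-(1 : ℝ)) := by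
  set L : ℝ := Real.log (Real.log (x : ℝ)) with hL
  set L₃ : ℝ := Real.log (Real.log (Real.log (x : ℝ))) with hL₃
  set lx : ℝ := Real.log (x : ℝ) with hlx
  -- basic positivity / comparisons of the scales
  have hL0 : 0 < L := by linarith
  have hlx0 : 0 < lx := by rw [hlx]; linarith
  have hL₃1 : 1 ≤ L₃ := h1
  have hL₃0 : 0 < L₃ := by linarith
  have hL₃L : L₃ ≤ L := by
    rw [hL₃]; exact (Real.log_le_sub_one_of_pos hL0).trans (by linarith)
  have hLlx : L ≤ lx := by
    rw [hL]; exact (Real.log_le_sub_one_of_pos hlx0).trans (by linarith)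
  have hU1 : 1 ≤ lx / L₃ := by
    rw [le_div_iff₀ hL₃0]; linarith
  have hUlx : lx / L₃ ≤ lx := div_le_self hlx0.le hL₃1
  have hU0 : 0 < lx / L₃ := by positivity
  -- `d ≤ Q ≤ (log x)³`
  have hQpos : 0 < (∏ p ∈ Nat.primesLE ⌊L⌋₊, p ^ 2) :=
    Finset.prod_pos fun p hp => pow_pos (Nat.prime_of_mem_primesLE hp).pos 2
  have hdQ' : (d : ℝ) ≤ lx ^ 3 := by
    have h := Nat.le_of_dvd hQpos hdQ
    have h' : ((∏ p ∈ Nat.primesLE ⌊L⌋₊, p ^ 2 : ℕ) : ℝ) ≤ lx ^ 3 := primesLE_sq_le_log_cube hlx1.le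
    exact le_trans (by exact_mod_cast h) h'
  have hd0 : (0 : ℝ) < d := by exact_mod_cast hd
  -- exponent: `Re z − 1 ≥ −3L`
  have hre : -(3 * L) ≤ z.re - 1 := by
    have h := Complex.abs_re_le_norm (z - 1)
    rw [Complex.sub_re, Complex.one_re] at h
    have := (abs_le.1 (h.trans hz)).1
    linarith
  -- the middle factor
  have hmid : lx ^ (-(3 * L)) ≤ (lx / L₃) ^ (((1 : ℕ) : ℝ) * (z.re - 1)) := by
    calc lx ^ (-(3 * L)) ≤ (lx / L₃) ^ (-(3 * L)) :=
          Real.rpow_le_rpow_of_nonpos hU0 hUlx (by linarith)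
      _ ≤ (lx / L₃) ^ (((1 : ℕ) : ℝ) * (z.re - 1)) :=
          Real.rpow_le_rpow_of_exponent_le hU1 (by push_cast; linarith)
  have hexp : Real.exp (0 * ‖(z : ℂ) - 1‖ * Real.log (‖(z : ℂ) - 1‖ + 2)) = 1 := by simp
  rw [hexp, mul_one]
  -- assemble: RHS ≥ (x/lx³)·lx^{−3L}·lx^{−1} = x·lx^{−(3L+4)} ≥ 1
  have hx0 : (0 : ℝ) < x := by
    have : (0 : ℝ) < lx := hlx0
    by_contra h
    have hx : (x : ℝ) = 0 := le_antisymm (not_lt.1 h) (Nat.cast_nonneg x)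
    rw [hlx, hx, Real.log_zero] at this
    exact lt_irrefl _ this
  have hpow : lx ^ (3 * L + 4) ≤ (x : ℝ) := hb
  have hsplit : lx ^ (-(3 * L + 4)) = (lx ^ 3)⁻¹ * lx ^ (-(3 * L)) * lx ^ (-(1 : ℝ)) := by
    rw [show (-(3 * L + 4) : ℝ) = (-3 : ℝ) + (-(3 * L)) + (-1) by ring, Real.rpow_add hlx0, Real.rpow_add hlx0,
      Real.rpow_neg hlx0.le, show ((3 : ℝ)) = ((3 : ℕ) : ℝ) by norm_num, Real.rpow_natCast]
  have hkey : 1 ≤ (x : ℝ) * lx ^ (-(3 * L + 4)) := by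
    rw [Real.rpow_neg hlx0.le, ← div_eq_mul_inv, le_div_iff₀ (Real.rpow_pos_of_pos hlx0 _), one_mul]
    exact hpow
  calc (1 : ℝ) ≤ (x : ℝ) * lx ^ (-(3 * L + 4)) := hkey
    _ = (x : ℝ) * (lx ^ 3)⁻¹ * lx ^ (-(3 * L)) * lx ^ (-(1 : ℝ)) := by rw [hsplit]; ring
    _ ≤ (x : ℝ) / (d : ℝ) * lx ^ (-(3 * L)) * lx ^ (-(1 : ℝ)) := by
        have hfac : (x : ℝ) * (lx ^ 3)⁻¹ ≤ (x : ℝ) / (d : ℝ) := by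
          rw [← div_eq_mul_inv]
          exact div_le_div_of_nonneg_left hx0.le hd0 hdQ'
        have hnn : 0 ≤ lx ^ (-(3 * L)) * lx ^ (-(1 : ℝ)) := by positivity
        nlinarith [hfac, hnn]
    _ ≤ (x : ℝ) / (d : ℝ) * (lx / L₃) ^ (((1 : ℕ) : ℝ) * (z.re - 1)) * lx ^ (-(1 : ℝ)) := by
        have h0 : 0 ≤ (x : ℝ) / (d : ℝ) := by positivity
        have h0' : 0 ≤ lx ^ (-(1 : ℝ)) := by positivity
        exact mul_le_mul_of_nonneg_right (mul_le_mul_of_nonneg_left hmid h0) h0'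

/-! ## (a) `leadingCoeff_pos` is NOT load-bearing — the conclusion holds for `![-X]` -/

/-- The conclusion of S5 HOLDS for `![-X]` (with `δ = 1`, `C = 0`): the typed rough statistic vanishes
(`Int.toNat (−n) = 0`), both sums count integers, `|N(d,a) − (x+1−m₀)/d| ≤ 1 ≤ budget`. [folklore] -/
theorem stubRoughEquidistribution_conclusion_negX :
    ∀ m₀ : ℕ, ∃ δ : ℝ, 0 < δ ∧ ∃ C : ℝ, ∃ x₀ : ℕ, ∀ x : ℕ, x₀ ≤ x → ∀ z : ℂ, ‖z - 1‖ ≤ 3 * Real.log (Real.log (x : ℝ)) →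
      ∀ d a : ℕ, 0 < d → d ∣ (∏ p ∈ Nat.primesLE ⌊Real.log (Real.log (x : ℝ))⌋₊, p ^ 2) →
        ‖(∑ n ∈ (Finset.Ico m₀ (x + 1)).filter (fun n : ℕ => n ≡ a [MOD d]), (z : ℂ) ^ (∑ i, ((((![-X] : Fin 1 → ℤ[X]) i).eval (n : ℤ)).toNat.factorization.sum fun p v => if Real.log (Real.log (x : ℝ)) < (p : ℝ) then min v 2 else 0))) -
            (∑ n ∈ Finset.Ico m₀ (x + 1), (z : ℂ) ^ (∑ i, ((((![-X] : Fin 1 → ℤ[X]) i).eval (n : ℤ)).toNat.factorization.sum fun p v => if Real.log (Real.log (x : ℝ)) < (p : ℝ) then min v 2 else 0))) / (d : ℂ)‖ ≤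
          (x : ℝ) / (d : ℝ) * (Real.log (x : ℝ) / Real.log (Real.log (Real.log (x : ℝ)))) ^ (((1 : ℕ) : ℝ) * (z.re - 1)) * Real.exp (C * ‖(z : ℂ) - 1‖ * Real.log (‖(z : ℂ) - 1‖ + 2)) *
            (Real.log (x : ℝ)) ^ (-(1 : ℝ)) := by
  intro m₀
  obtain ⟨x₀, hx₀⟩ := Filter.eventually_atTop.1 eventually_junk_scales
  refine ⟨1, one_pos, 0, x₀, fun x hx z hz d a hd hdQ => ?_⟩
  obtain ⟨h3, h1, hl1, hb⟩ := hx₀ x hx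
  refine le_trans (norm_classSum_sub_le_one_of_stat_zero (fun n => roughStat_negX _ n) m₀ x a hd z) ?_
  exact one_le_junk_budget h3 h1 hl1 hb hz hd hdQ

/-! ## (b) `hasNoFixedPrimeDivisor` is NOT load-bearing — the conclusion holds for `![C 3]` -/

/-- The conclusion of S5 HOLDS for the constant prime `![C 3]` (fixed prime divisor `3`; `δ = 1`, `C = 0`): once
`log log x ≥ 3` the prime `3` is smooth, the rough statistic vanishes and the same squeeze applies. [folklore] -/
theorem stubRoughEquidistribution_conclusion_C_three :
    ∀ m₀ : ℕ, ∃ δ : ℝ, 0 < δ ∧ ∃ C : ℝ, ∃ x₀ : ℕ, ∀ x : ℕ, x₀ ≤ x → ∀ z : ℂ, ‖z - 1‖ ≤ 3 * Real.log (Real.log (x : ℝ)) →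
      ∀ d a : ℕ, 0 < d → d ∣ (∏ p ∈ Nat.primesLE ⌊Real.log (Real.log (x : ℝ))⌋₊, p ^ 2) →
        ‖(∑ n ∈ (Finset.Ico m₀ (x + 1)).filter (fun n : ℕ => n ≡ a [MOD d]), (z : ℂ) ^ (∑ i, ((((![(Polynomial.C 3 : ℤ[X])] : Fin 1 → ℤ[X]) i).eval (n : ℤ)).toNat.factorization.sum fun p v => if Real.log (Real.log (x : ℝ)) < (p : ℝ) then min v 2 else 0))) -
            (∑ n ∈ Finset.Ico m₀ (x + 1), (z : ℂ) ^ (∑ i, ((((![(Polynomial.C 3 : ℤ[X])] : Fin 1 → ℤ[X]) i).eval (n : ℤ)).toNat.factorization.sum fun p v => if Real.log (Real.log (x : ℝ)) < (p : ℝ) then min v 2 else 0))) / (d : ℂ)‖ ≤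
          (x : ℝ) / (d : ℝ) * (Real.log (x : ℝ) / Real.log (Real.log (Real.log (x : ℝ)))) ^ (((1 : ℕ) : ℝ) * (z.re - 1)) * Real.exp (C * ‖(z : ℂ) - 1‖ * Real.log (‖(z : ℂ) - 1‖ + 2)) *
            (Real.log (x : ℝ)) ^ (-(1 : ℝ)) := by
  intro m₀
  obtain ⟨x₀, hx₀⟩ := Filter.eventually_atTop.1 eventually_junk_scales
  refine ⟨1, one_pos, 0, x₀, fun x hx z hz d a hd hdQ => ?_⟩
  obtain ⟨h3, h1, hl1, hb⟩ := hx₀ x hx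
  refine le_trans (norm_classSum_sub_le_one_of_stat_zero (fun n => roughStat_C_three h3 n) m₀ x a hd z) ?_
  exact one_le_junk_budget h3 h1 hl1 hb hz hd hdQ

end Summit.Parity.BatemanHorn.Theorems.SystemZeroRepulsion.Negative
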